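import Literature.Claims.NS.Cox2025
import HarnessLib

/-!
# C168 `Cox2025` — refuter-of-record kit (ns-claims-refuter-5 g4): the Kenig–Merle set-up is entered
# through an empty door

D-0090 NS-CLAIMS SWEEP, cell `ns-claims`, claim C168 (RULINGS v1.43); skeleton
`Literature.Claims.NS.Cox2025` (ns-claims-typist-5 g7, p543106, sha16 `2117fa6383bdd216`); text of record
Zenodo 17503936 v2 «Navier-StokesFINAL.Submit.8.pdf», sha16 `2301be9c1f617287`, 124 pp. (census pin
`census/texts/Cox2025/`; «p.N l.M» = line M of `pNNN.txt`).

**Where the typed chain breaks.** The composition `claim_of_steps K hloc hset h1 h2 h3 h4 h5` (route R1,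
Thm 9.6 «Mechanism» p.44 l.33–35) consumes, in dependency order, `Step_local` (TRUE, tree) and then
`Step_setup` — §4 «Setup for the KL chain» p.19 l.15–31 with (4.1) «δ := M_c − lim sup_n sup_t ‖u^n(t)‖_{L³}
> 0», KL-1 p.20 l.4–6 «sup_{t≤0}‖u∞(t)‖_{L³} ≤ M_c < ∞», Thm G.5 proof (i) p.107 l.37–45 «Define M∗ := inf{…}
(G.30). Pick a sequence u^n with sup_{t<T_n}‖u^n(t)‖_{L³} ↓ M∗ and T_n < ∞»: a singularity ⇒ minimising
blow-up data at a FINITE minimal critical level. Recorded here, Theorems-side, by name against the landed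
skeleton:
* the set-up's output is UNINHABITED — `critLevel_eq_top'` / `not_minimisingData'`: by the
  Escauriaza–Seregin–Šverák continuation theorem of the tree (the text's own endpoint reference [11], p.5
  l.19–21, p.19 l.11–12) every singular finite-energy classical solution from a datum of class (4) has
  `sup_{t<T∗}‖u(t)‖_{L³} = ∞`, so the «minimal blow-up threshold» is `M_c = +∞` and no sequence of blow-up
  solutions has finite levels;
* hence the set-up step FAILS EXACTLY ON A BLOW-UP — `not_step_setup_iff_exists_singular` — and is
  EQUIVALENT TO THE CLAIMED THEOREM and to Clay (A) — `step_setup_iff_claimedTheorem'`, `step_setup_iff_clayA`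
  (the step restates the problem; nothing in the 124 pp. derives a finite critical level from «a smooth
  solution develops a singularity at a finite time T∗», p.19 l.15–16 — App. F.4 runs under the standing
  hypothesis (F.22) p.96 l.29–32 «‖u‖_{L^∞_t L³_x((−∞,T∗))} ≤ M < ∞»);
* downstream, KL-1 at the grain of its proof is VACUOUSLY TRUE (`step_KL1_holds'`, input uninhabited) and
  KL-1 AS PRINTED, bare (Prop 4.1 p.20 l.1–12 «There exists a nontrivial ancient suitable solution … ≤ M_c <
  ∞») is KERNEL-FALSE (`not_Step_KL1_bare`); the binders KL-1 … KL-5 of the composition are DECORATION: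
  `claimedTheorem_of_setup` derives the claimed theorem from `Step_setup` ALONE.

Class words are the chair's; this file asserts nothing about App. D/E/F (KL-2 … KL-7, Thm 7.2 are typed over
posited kits or open-strength classes and carry no kernel object here).

WHAT THIS IS NOT: not a claim about NS regularity or blow-up; not a claim about any author beyond the
typed locator.
-/

noncomputable section

set_option linter.dupNamespace false

open Set Function Filter MeasureTheory
open scoped Topology ENNReal NNReal

namespace Summit.NavierStokesRegularity.NavierStokesRegularity.Theorems.Cox2025

open Literature.Analysis Literature.Analysis.FluidPDE Literature.Claims.NS.ClayVariants
open Literature.Claims.NS.Cox2025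

/-! ### The set-up's object: the minimal blow-up threshold is `+∞`, the minimising data do not exist -/

/-- **M_c = +∞** ((4.1) p.19 l.21–27; (G.30) p.107 l.38–40): TYPE-EXACT by name against the skeleton's
`critLevel_eq_top` (tree ESS door `IsClassicalNSSolutionOn.exists_Icc_of_eLpNorm_three_bounded`).
[cite: Cox2025, (4.1) p.19 l.21–27; (G.30) p.107 l.38–40] [cite: EscauriazaSereginSverak2003, Thm. 1.4] -/
theorem critLevel_eq_top' : critLevel = ⊤ := critLevel_eq_top

/-- **No minimising blow-up data** (Thm G.5 proof (i) p.107 l.41–45 «Pick a sequence u^n with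
sup_{t<T_n}‖u^n(t)‖_{L³} ↓ M∗ and T_n < ∞»; Def F.7 (F.22) p.96 l.29–32). [cite: Cox2025, Thm G.5 proof (i) p.107 l.41–45]
[cite: EscauriazaSereginSverak2003, Thm. 1.4] -/
theorem not_minimisingData' : ¬ MinimisingData := not_minimisingData

/-- Every singular solution from a datum of class (4) has infinite critical level (p.19 l.15–16 × (F.22)
p.96 l.29–32): the class «singular ∧ sup_{t<T∗}‖u(t)‖_{L³} < ∞» of the §4 set-up is EMPTY.
[cite: Cox2025, §4 p.19 l.15–16; Def F.7 (F.22) p.96 l.29–32] [cite: EscauriazaSereginSverak2003, Thm. 1.4] -/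
theorem no_singular_with_finite_level {u₀ : E3 → E3} {T : ℝ} {u : ℝ → E3 → E3} {p : ℝ → E3 → ℝ}
    (hd : IsDatum u₀) (hs : IsSingular u₀ T u p) (hfin : L3sup T u < ⊤) : False :=
  hfin.ne (L3sup_eq_top_of_singular hd hs)

/-! ### The set-up step fails exactly on a blow-up; it is the claimed theorem; it is Clay (A) -/

/-- **`Step_setup` fails if and only if some datum of class (4) carries a singular solution.**
[cite: Cox2025, §4 p.19 l.15–31; Thm G.5 proof (i) p.107 l.37–45] [cite: EscauriazaSereginSverak2003, Thm. 1.4] -/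
theorem not_step_setup_iff_exists_singular :
    ¬ Step_setup ↔
      ∃ (u₀ : E3 → E3) (T : ℝ) (u : ℝ → E3 → E3) (p : ℝ → E3 → ℝ), IsDatum u₀ ∧ IsSingular u₀ T u p := by
  constructor
  · intro h
    by_contra hne
    exact h fun hex => absurd hex hne
  · intro hex h
    exact not_minimisingData (h hex)

/-- **`Step_setup` holds if and only if no datum of class (4) carries a singular solution** (`NoSingular`).
[cite: Cox2025, §4 p.19 l.15–31] [cite: EscauriazaSereginSverak2003, Thm. 1.4] -/
theorem step_setup_iff_noSingular : Step_setup ↔ NoSingular :=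
  ⟨fun h hex => not_minimisingData (h hex), fun h hex => absurd hex h⟩

/-- **ROUTE-5b certificate, TYPE-EXACT by name: the set-up step ⇔ the claimed theorem** (skeleton
`step_setup_iff_claimedTheorem`). [cite: Cox2025, §4 p.19 l.15–31; Thm 9.6 p.44 l.26–35] -/
theorem step_setup_iff_claimedTheorem' : Step_setup ↔ ClaimedTheorem := step_setup_iff_claimedTheorem

/-- **The set-up step ⇔ Clay (A)** (`clayR3.Regularity`, every viscosity; the claimed theorem is (A) by the
skeleton's `claimedTheorem_iff_clayA`). [cite: Cox2025, §4 p.19 l.15–31] [cite: FeffermanClay2006, (A) with (4) (6) (7) p.2] -/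
theorem step_setup_iff_clayA : Step_setup ↔ clayR3.Regularity :=
  step_setup_iff_claimedTheorem.trans claimedTheorem_iff_clayA

/-- **DECORATION: the claimed theorem follows from `Step_setup` ALONE** — in `claim_of_steps K hloc hset h1
h2 h3 h4 h5` the binders `h1 … h5` (KL-1 … KL-5) and the kit `K` carry no load.
[cite: Cox2025, Thm 9.6 p.44 l.33–35] -/
theorem claimedTheorem_of_setup (hset : Step_setup) : ClaimedTheorem := step_setup_iff_claimedTheorem.1 hset

/-- … and conversely every proof of the claimed theorem proves the set-up step (vacuously).
[cite: Cox2025, §4 p.19 l.15–31] -/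
theorem step_setup_of_claimedTheorem (h : ClaimedTheorem) : Step_setup := step_setup_iff_claimedTheorem.2 h

/-! ### KL-1: vacuous at the grain of its proof, false as printed bare -/

/-- **KL-1 (Prop 4.1 at the App. F.4 grain) holds VACUOUSLY** — TYPE-EXACT by name (skeleton
`step_KL1_holds`; input `MinimisingData` uninhabited). [cite: Cox2025, Prop 4.1 p.19 l.32 – p.20 l.16; Def F.7 (F.22) p.96 l.29–32] -/
theorem step_KL1_holds' : Step_KL1 := step_KL1_holds

/-- **KL-1 AS PRINTED, bare, is false in the kernel**: Prop 4.1 p.20 l.1–12 asserts a nontrivial ancient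
APMS profile with «sup_{t≤0}‖u∞(t)‖_{L³} ≤ M_c < ∞», and `M_c = ⊤`. (Recorded face; RULINGS v1.43 hazard
(b): the consumed KL-1 carries the blow-up hypothesis.) [cite: Cox2025, Prop 4.1 p.20 l.1–12]
[cite: EscauriazaSereginSverak2003, Thm. 1.4] -/
theorem not_Step_KL1_bare : ¬ Step_KL1_bare := by
  rintro ⟨-, -, -, -, -, hlt⟩
  rw [critLevel_eq_top] at hlt
  exact lt_irrefl _ hlt

/-- The hypothesis-carrying printed KL-1 (§4 p.19 l.15–18 + Prop 4.1) ⇔ the claimed theorem — TYPE-EXACT by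
name (skeleton `step_KL1_hyp_iff_claimedTheorem`). [cite: Cox2025, §4 p.19 l.15–18; Prop 4.1 p.20 l.1–12] -/
theorem step_KL1_hyp_iff_claimedTheorem' : Step_KL1_hyp ↔ ClaimedTheorem := step_KL1_hyp_iff_claimedTheorem

/-- Lemma 1.12 / (4.1) / (2.8) («δ := M_c − lim sup_n sup_t‖u^n(t)‖_{L³} > 0», p.8 l.59–62, p.12 l.1–5,
p.19 l.21–27) presuppose a finite `M_c`; in the kernel no real number lies strictly below `M_c` with a
positive gap in `ℝ≥0∞` other than through `⊤`-arithmetic: `M_c - a = ⊤` for every finite level `a`.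
[cite: Cox2025, Lemma 1.12 p.8 l.59–62; (4.1) p.19 l.21–27] -/
theorem critLevel_sub_eq_top {a : ℝ≥0∞} (ha : a < ⊤) : critLevel - a = ⊤ := by
  rw [critLevel_eq_top]
  exact ENNReal.top_sub ha.ne

/-! ### ON-PATH and guards (records) -/

/-- ON-PATH: the composition of record in binder order, and its collapse onto binder 2. -/
example (K : CarlemanKit) (hloc : Step_local) (hset : Step_setup) (h1 : Step_KL1) (h2 : Step_KL2)
    (h3 : Step_KL3 K) (h4 : Step_KL4) (h5 : Step_KL5_of K) : ClaimedTheorem :=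
  claim_of_steps K hloc hset h1 h2 h3 h4 h5

example (hset : Step_setup) : ClaimedTheorem := claimedTheorem_of_setup hset

/-- FQN guards: the decls named in the verdict are the skeleton's. -/
example : Literature.Claims.NS.Cox2025.Step_setup ↔ Literature.Claims.NS.Cox2025.ClaimedTheorem :=
  step_setup_iff_claimedTheorem'
example : ¬ Literature.Claims.NS.Cox2025.Step_KL1_bare := not_Step_KL1_bare
example : ¬ Literature.Claims.NS.Cox2025.MinimisingData := not_minimisingData'
example : Literature.Claims.NS.Cox2025.Step_KL1 := step_KL1_holds'
example : Literature.Claims.NS.Cox2025.critLevel = ⊤ := critLevel_eq_top'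

end Summit.NavierStokesRegularity.NavierStokesRegularity.Theorems.Cox2025

end

-- WHAT THIS IS NOT: not a claim about NS regularity or blow-up; not a claim about any author beyond the typed locator.
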